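import Mathlib
import HarnessLib
import Summits.HubbardSuperconductivity.HubbardSuperconductivity.Theorems.KLProgrammeKLRegimeEnginePairTransferDLineEdgeForward

/-!
# Route `KLProgramme` — ENGINE item stmt-HubbardSuperconductivity-20437, class-#5 STEP (X).3 rows form: the PINNED PAIR's CROSSED `D`-row `Rx₁` with the KERNEL SPLIT
# `V_j⊗V_j = F¹ + F²` / the λ/W split `= c + F_W` (AMENDMENT 25 door (ii); crossed twin of …DLineEdgeSplit; cell gate-hubbard-kl, seat hubbard-kl-k3c2-p2 g20)

WHY.  Same as …DLineEdgeSplit for the crossed row `hx₁` of `klmd_defectDiff_le_rows_family` at the pinned pair: the crossed signed sum (bosonic shift `2π/β` between the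
partner frequencies, transfer `Q_m − x − y`, window `G|p_{Q_m−x−y}| ≤ Λₙ₊₁/16`, `16π/β ≤ Λₙ₊₁`) is linear in the resolved kernel `F p p′`, so the λ/W split is bookkeeping:
* §1 **`klms_adjacent_crossed_signed_le_gen`** — `klms_dLine_adjacent_crossed_signed_le` for an ARBITRARY kernel `F` with momentum pin `F₀` (data `A₀, L_A` on the pin along the
  lines `k ↦ (k, k + q̃)` and `k ↦ (k − q̃, k)`, flatness `ε` on `ω² ≤ (5Λₙ₊₁)²` at crossed frequencies);
* §2 `pinned_crossed_sum_kernel_add` / `_congr`;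
* §3 **`dLine_pinned_crossed_signed_le_split`** — any split `F¹ + F²`, read at `n+2`: bound¹ + bound² (each `(βL²)²(βL²Row_{n+2}(|−2π/β| + G r) + βL²Row_{n+2}(|2π/β| + G r)) + εⁱ·flat`);
* §4 **`dLine_pinned_crossed_signed_le_split_const`** — `F¹ := c` constant: data `(‖c‖, 0, 0)` proved ⇒ its row is pure zero sound (`pinned_row_le_slots_shift` with `L_A = 0`:
  ov + thermal (incl. the shift) + min_x + the A₀-lattice), the W part is AMENDMENT 25's flat cubic.
Pure composition; nothing about the model's effective action is asserted; nothing asserts (X).3, (c), K3 or superconductivity.  0 kit · 0 lit.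
-/

noncomputable section

namespace Summit.HubbardSuperconductivity.HubbardSuperconductivity.Theorems.KLRegimeSplit

set_option linter.dupNamespace false -- summit = problem name (single-conjunct summit), D-0017

open Real Set Finset Complex Literature.MathematicalPhysics.QuantumLattice
open Literature.Probability.LatticeModels hiding torusSupNorm
open Literature.MathematicalPhysics.QuantumLattice.BandSectorCounting
open Summit.HubbardSuperconductivity.HubbardSuperconductivity.Theorems.KLProgrammeLegKernels
open Summit.HubbardSuperconductivity.HubbardSuperconductivity.Theorems.KLRegimeWick
open Summit.HubbardSuperconductivity.HubbardSuperconductivity.Theorems.TwoPointAssembly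
open Summit.HubbardSuperconductivity.HubbardSuperconductivity.Theorems.DispersionFlow
open Summit.HubbardSuperconductivity.HubbardSuperconductivity.Theorems.PerturbedFermiCurve

variable {L M : ℕ} [NeZero L] [NeZero M] (β μ : ℝ) (K : TrigPolyC4v)

/-! ## §1 The adjacent-pair crossed `D`-row for a generic resolved kernel -/

section Gen

variable {a' b' : ℝ} (B : BandBounds a' b') {R : RenConsts} {U : ℝ} {N : ℕ} {A : ℝ}

/-- **ADJACENT-PAIR CROSSED `D`-ROW, GENERIC KERNEL**: pair `(j, n+1)`, `n+1 ≤ j`, `D = s_{n+1,j} − s_{n+1,n+1}`, `q̃ = Q_m − x − y` with `G|p_q̃|_𝕋 ≤ Λₙ₊₁/8`, `16π/β ≤ Λₙ₊₁`,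
kernel `F` with momentum pin `F₀` (`A₀`/`L_A` on `k ↦ F₀ k (k + q̃)` and `k ↦ F₀ (k − q̃) k`; `ε` the crossed flatness) ⟹
`‖S_{D,x}[F]‖ ≤ (βL²)²(βL²·Row_j(|−2π/β| + G|p_q̃|) + βL²·Row_j(|2π/β| + G|p_q̃|)) + ε·(256/3)(βL²)²/Λ(t)²·Σ|D|‖ĝ‖`. -/
theorem klms_adjacent_crossed_signed_le_gen (hR : ∀ j, 0 ≤ R.Gfr j) (hK : FrameOK R U N μ K)
    (hAb : ∀ p : Momentum, ∀ j ≤ 2, ‖iteratedFDeriv ℝ j (frameShift K) p‖ ≤ A) (hA : 4 * A < B.Dtmin) (hA20 : 4 * A ≤ 1 / 20) (hμ : μ ≤ -0.15)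
    (n : ℕ) {t : ℝ} (ht : t ∈ Icc (0 : ℝ) 1) (hβ : klBetaMin ≤ β) (hn : n + 1 ≤ nScales β + 1) (hβn : 16 * π / β ≤ klScale klE0 (n + 1))
    (hM : β * (4 * klScale klE0 (n + 1)) / (2 * Real.pi) + 1 ≤ M)
    (Wd : ℝ → FreqMomentum L M → ℝ) (hWd : Wd = fun t k => deriv (fun Λ' : ℝ => hubbardCutoffWeightCT L M β μ K Λ' k) (klScale klE0 n + t * (klScale klE0 (n + 1) - klScale klE0 n)))
    {j : ℕ} (hj : n + 1 ≤ j) (Qm x y : TorusSite 2 L)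
    (hlo : a' < μ - 4 * klScale klE0 (n + 1) - 4 * A) (hhi : μ + 4 * klScale klE0 (n + 1) + 4 * A < b')
    (hq : (4 + 8 / 3 * R.Gfr 1 * U ^ 2) * klTorusNorm L (Qm - x - y) ≤ klScale klE0 (n + 1) / 8)
    (F : FreqMomentum L M → FreqMomentum L M → ℂ) (F₀ : TorusSite 2 L → TorusSite 2 L → ℂ)
    {A₀ LA ε : ℝ} (hA0 : 0 ≤ A₀) (hLA : 0 ≤ LA) (hε : 0 ≤ ε)
    (hY0B : ∀ k : TorusSite 2 L, ‖F₀ k (k + (Qm - x - y))‖ ≤ A₀)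
    (hY1B : ∀ k k' : TorusSite 2 L, ‖F₀ k (k + (Qm - x - y)) - F₀ k' (k' + (Qm - x - y))‖ ≤ LA * klTorusNorm L (k - k'))
    (hY0A : ∀ k : TorusSite 2 L, ‖F₀ (k + -(Qm - x - y)) k‖ ≤ A₀)
    (hY1A : ∀ k k' : TorusSite 2 L, ‖F₀ (k + -(Qm - x - y)) k - F₀ (k' + -(Qm - x - y)) k'‖ ≤ LA * klTorusNorm L (k - k'))
    (hflat : ∀ (i i' : MatsubaraIdx M) (k k' : TorusSite 2 L), matsubaraInt M i' + 1 = matsubaraInt M i →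
      matsubaraFreq β M i ^ 2 ≤ (5 * klScale klE0 (n + 1)) ^ 2 → ‖F (i, k) (i', k') - F₀ k k'‖ ≤ ε) :
    ‖∑ p : FreqMomentum L M, ∑ p' : FreqMomentum L M,
        if matsubaraInt M p'.1 + matsubaraInt M (omega0 M) + matsubaraInt M (omega0 M) + 1 = matsubaraInt M p.1 ∧ p'.2 = p.2 + Qm - x - y then
          ((((((softSymbolCompl L M β μ K (n + 1) j p - softSymbolCompl L M β μ K (n + 1) (n + 1) p) : ℝ) : ℂ) * (((β * (L : ℝ) ^ 2 : ℝ) : ℂ) * propCT L M β μ K p)) *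
                ((((Wd t p') : ℝ) : ℂ) * (((β * (L : ℝ) ^ 2 : ℝ) : ℂ) * propCT L M β μ K p'))) +
              (((((Wd t p) : ℝ) : ℂ) * (((β * (L : ℝ) ^ 2 : ℝ) : ℂ) * propCT L M β μ K p)) *
                ((((softSymbolCompl L M β μ K (n + 1) j p' - softSymbolCompl L M β μ K (n + 1) (n + 1) p') : ℝ) : ℂ) * (((β * (L : ℝ) ^ 2 : ℝ) : ℂ) * propCT L M β μ K p')))) *
            F p p'
        else 0‖ ≤
      (β * (L : ℝ) ^ 2) ^ 2 *
          (β * (L : ℝ) ^ 2 * klmsRowBound B.Dtmin A (4 + 8 / 3 * R.Gfr 1 * U ^ 2) A₀ LA β n j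
              (|-(2 * π / β)| + (4 + 8 / 3 * R.Gfr 1 * U ^ 2) * klTorusNorm L (Qm - x - y)) L +
            β * (L : ℝ) ^ 2 * klmsRowBound B.Dtmin A (4 + 8 / 3 * R.Gfr 1 * U ^ 2) A₀ LA β n j
              (|2 * π / β| + (4 + 8 / 3 * R.Gfr 1 * U ^ 2) * klTorusNorm L (Qm - x - y)) L) +
        ε * (256 / 3 * (β * (L : ℝ) ^ 2) ^ 2 / (klScale klE0 n + t * (klScale klE0 (n + 1) - klScale klE0 n)) ^ 2 *
          ∑ p : FreqMomentum L M, |softSymbolCompl L M β μ K (n + 1) j p - softSymbolCompl L M β μ K (n + 1) (n + 1) p| * ‖propCT L M β μ K p‖) := by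
  have hβ0 : 0 < β := lt_of_lt_of_le (by norm_num [klBetaMin]) hβ
  have hhi1 : klScale klE0 (n + 1) ≤ klScale klE0 n := by rw [klth_klScale_succ]; linarith [klth_klScale_pos n]
  have h0 := klms_weighted_crossed_norm_le β μ K hβ0 n ht hβn hM
    (fun p => softSymbolCompl L M β μ K (n + 1) j p - softSymbolCompl L M β μ K (n + 1) (n + 1) p)
    (klPhiC (klScale klE0 j) (klScale klE0 (n + 1))) (fun p => klfw_dLine_line_eq μ K hβ0.ne' n j (n + 1) p) Wd hWd F F₀ Qm x y hε hflat
  have h2π : |2 * π / β| ≤ klScale klE0 (n + 1) / 8 := by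
    rw [abs_of_pos (by positivity)]
    have : 2 * π / β = (16 * π / β) / 8 := by ring
    rw [this]; exact div_le_div_of_nonneg_right hβn (by norm_num)
  have h2π' : |-(2 * π / β)| ≤ klScale klE0 (n + 1) / 8 := by rw [abs_neg]; exact h2π
  have h1 := klms_pinned_bubble_norm_le_gen β μ K B hR hK hAb hA hA20 hμ n ht hj le_rfl hhi1 hlo hhi hβ hn hM (Qm - x - y) hq h2π' hA0 hLA
    (Y := fun k : TorusSite 2 L => F₀ k (k + (Qm - x - y))) hY0B hY1B
  have hq' : (4 + 8 / 3 * R.Gfr 1 * U ^ 2) * klTorusNorm L (-(Qm - x - y)) ≤ klScale klE0 (n + 1) / 8 := by rwa [klTorusNorm_neg]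
  have h2 := klms_pinned_bubble_norm_le_gen β μ K B hR hK hAb hA hA20 hμ n ht hj le_rfl hhi1 hlo hhi hβ hn hM (-(Qm - x - y)) hq' h2π hA0 hLA
    (Y := fun k : TorusSite 2 L => F₀ (k + -(Qm - x - y)) k) hY0A hY1A
  rw [klTorusNorm_neg] at h2
  exact h0.trans (add_le_add (mul_le_mul_of_nonneg_left (add_le_add h1 h2) (by positivity)) le_rfl)

end Gen

/-! ## §2 The literal crossed sum is additive in the kernel -/

omit [NeZero M] in
/-- The literal crossed sum with kernel `F¹ + F²` is the sum of the two literal sums (any weights). -/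
theorem pinned_crossed_sum_kernel_add (P : FreqMomentum L M → FreqMomentum L M → Prop) [∀ p p', Decidable (P p p')]
    (ln : FreqMomentum L M → FreqMomentum L M → ℂ) (F₁ F₂ : FreqMomentum L M → FreqMomentum L M → ℂ) :
    (∑ p : FreqMomentum L M, ∑ p' : FreqMomentum L M, if P p p' then ln p p' * (F₁ p p' + F₂ p p') else 0) =
      (∑ p : FreqMomentum L M, ∑ p' : FreqMomentum L M, if P p p' then ln p p' * F₁ p p' else 0) +
        ∑ p : FreqMomentum L M, ∑ p' : FreqMomentum L M, if P p p' then ln p p' * F₂ p p' else 0 := by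
  rw [← Finset.sum_add_distrib]
  refine Finset.sum_congr rfl fun p _ => ?_
  rw [← Finset.sum_add_distrib]
  refine Finset.sum_congr rfl fun p' _ => ?_
  split_ifs
  · ring
  · simp

omit [NeZero M] in
/-- The literal crossed sum depends on the kernel only through its values. -/
theorem pinned_crossed_sum_kernel_congr (P : FreqMomentum L M → FreqMomentum L M → Prop) [∀ p p', Decidable (P p p')]
    (ln : FreqMomentum L M → FreqMomentum L M → ℂ) {F G : FreqMomentum L M → FreqMomentum L M → ℂ} (h : ∀ p p', F p p' = G p p') :
    (∑ p : FreqMomentum L M, ∑ p' : FreqMomentum L M, if P p p' then ln p p' * F p p' else 0) =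
      ∑ p : FreqMomentum L M, ∑ p' : FreqMomentum L M, if P p p' then ln p p' * G p p' else 0 := by
  refine Finset.sum_congr rfl fun p _ => Finset.sum_congr rfl fun p' _ => ?_
  rw [h p p']

/-! ## §3 The pinned pair's crossed `D`-row with a kernel split -/

section Split

variable {a' b' : ℝ} (B : BandBounds a' b') {R : RenConsts} {U : ℝ} {N : ℕ} {A : ℝ}

/-- **THE PINNED PAIR's CROSSED `D`-ROW WITH A KERNEL SPLIT `V_j⊗V_j = F¹ + F²`** (`n+2 ≤ j`, window `G|p_{Q_m−x−y}| ≤ Λₙ₊₁/16`, `16π/β ≤ Λₙ₊₁`, read at `n+2`). -/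
theorem dLine_pinned_crossed_signed_le_split (hR : ∀ j, 0 ≤ R.Gfr j) (hK : FrameOK R U N μ K)
    (hAb : ∀ p : Momentum, ∀ j ≤ 2, ‖iteratedFDeriv ℝ j (frameShift K) p‖ ≤ A) (hA : 4 * A < B.Dtmin) (hA20 : 4 * A ≤ 1 / 20) (hμ : μ ≤ -0.15)
    (n : ℕ) {t : ℝ} (ht : t ∈ Icc (0 : ℝ) 1) (hβ : klBetaMin ≤ β) (hn : n + 1 ≤ nScales β + 1) (hβn : 16 * π / β ≤ klScale klE0 (n + 1))
    (hM : β * (4 * klScale klE0 (n + 1)) / (2 * Real.pi) + 1 ≤ M)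
    (Wd : ℝ → FreqMomentum L M → ℝ) (hWd : Wd = fun t k => deriv (fun Λ' : ℝ => hubbardCutoffWeightCT L M β μ K Λ' k) (klScale klE0 n + t * (klScale klE0 (n + 1) - klScale klE0 n)))
    (V : ℕ → ℝ → (Fin 4 → HubbardFieldIdx L M) → ℂ) {j : ℕ} (hj : n + 2 ≤ j) (Qm x y : TorusSite 2 L)
    (hlo : a' < μ - 4 * klScale klE0 (n + 1) - 4 * A) (hhi : μ + 4 * klScale klE0 (n + 1) + 4 * A < b')
    (hq : (4 + 8 / 3 * R.Gfr 1 * U ^ 2) * klTorusNorm L (Qm - x - y) ≤ klScale klE0 (n + 1) / 16)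
    (F₁ F₂ : FreqMomentum L M → FreqMomentum L M → ℂ) (F₁₀ F₂₀ : TorusSite 2 L → TorusSite 2 L → ℂ)
    (hsplit : ∀ (p p' : FreqMomentum L M),
      V j t ![((p, 0), 1), ((p', 1), 0), (((omega0 M, y), 0), 0), ((((omega0 M).rev, Qm - x), 1), 1)] *
          V j t ![((p, 0), 0), ((p', 1), 1), ((((omega0 M).rev, Qm - y), 1), 0), (((omega0 M, x), 0), 1)] = F₁ p p' + F₂ p p')
    {A₁ L₁ ε₁ A₂ L₂ ε₂ : ℝ} (hA1 : 0 ≤ A₁) (hL1 : 0 ≤ L₁) (hε1 : 0 ≤ ε₁) (hA2 : 0 ≤ A₂) (hL2 : 0 ≤ L₂) (hε2 : 0 ≤ ε₂)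
    (hY0B₁ : ∀ k : TorusSite 2 L, ‖F₁₀ k (k + (Qm - x - y))‖ ≤ A₁)
    (hY1B₁ : ∀ k k' : TorusSite 2 L, ‖F₁₀ k (k + (Qm - x - y)) - F₁₀ k' (k' + (Qm - x - y))‖ ≤ L₁ * klTorusNorm L (k - k'))
    (hY0A₁ : ∀ k : TorusSite 2 L, ‖F₁₀ (k + -(Qm - x - y)) k‖ ≤ A₁)
    (hY1A₁ : ∀ k k' : TorusSite 2 L, ‖F₁₀ (k + -(Qm - x - y)) k - F₁₀ (k' + -(Qm - x - y)) k'‖ ≤ L₁ * klTorusNorm L (k - k'))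
    (hflat₁ : ∀ (i i' : MatsubaraIdx M) (k k' : TorusSite 2 L), matsubaraInt M i' + 1 = matsubaraInt M i →
      matsubaraFreq β M i ^ 2 ≤ (5 * klScale klE0 (n + 1)) ^ 2 → ‖F₁ (i, k) (i', k') - F₁₀ k k'‖ ≤ ε₁)
    (hY0B₂ : ∀ k : TorusSite 2 L, ‖F₂₀ k (k + (Qm - x - y))‖ ≤ A₂)
    (hY1B₂ : ∀ k k' : TorusSite 2 L, ‖F₂₀ k (k + (Qm - x - y)) - F₂₀ k' (k' + (Qm - x - y))‖ ≤ L₂ * klTorusNorm L (k - k'))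
    (hY0A₂ : ∀ k : TorusSite 2 L, ‖F₂₀ (k + -(Qm - x - y)) k‖ ≤ A₂)
    (hY1A₂ : ∀ k k' : TorusSite 2 L, ‖F₂₀ (k + -(Qm - x - y)) k - F₂₀ (k' + -(Qm - x - y)) k'‖ ≤ L₂ * klTorusNorm L (k - k'))
    (hflat₂ : ∀ (i i' : MatsubaraIdx M) (k k' : TorusSite 2 L), matsubaraInt M i' + 1 = matsubaraInt M i →
      matsubaraFreq β M i ^ 2 ≤ (5 * klScale klE0 (n + 1)) ^ 2 → ‖F₂ (i, k) (i', k') - F₂₀ k k'‖ ≤ ε₂) :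
    ‖∑ p : FreqMomentum L M, ∑ p' : FreqMomentum L M,
        if matsubaraInt M p'.1 + matsubaraInt M (omega0 M) + matsubaraInt M (omega0 M) + 1 = matsubaraInt M p.1 ∧ p'.2 = p.2 + Qm - x - y then
          ((((((softSymbolCompl L M β μ K (n + 1) j p - softSymbolCompl L M β μ K (n + 1) (n + 1) p) : ℝ) : ℂ) * (((β * (L : ℝ) ^ 2 : ℝ) : ℂ) * propCT L M β μ K p)) *
                ((((Wd t p') : ℝ) : ℂ) * (((β * (L : ℝ) ^ 2 : ℝ) : ℂ) * propCT L M β μ K p'))) +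
              (((((Wd t p) : ℝ) : ℂ) * (((β * (L : ℝ) ^ 2 : ℝ) : ℂ) * propCT L M β μ K p)) *
                ((((softSymbolCompl L M β μ K (n + 1) j p' - softSymbolCompl L M β μ K (n + 1) (n + 1) p') : ℝ) : ℂ) * (((β * (L : ℝ) ^ 2 : ℝ) : ℂ) * propCT L M β μ K p')))) *
            (V j t ![((p, 0), 1), ((p', 1), 0), (((omega0 M, y), 0), 0), ((((omega0 M).rev, Qm - x), 1), 1)] *
              V j t ![((p, 0), 0), ((p', 1), 1), ((((omega0 M).rev, Qm - y), 1), 0), (((omega0 M, x), 0), 1)])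
        else 0‖ ≤
      ((β * (L : ℝ) ^ 2) ^ 2 *
          (β * (L : ℝ) ^ 2 * klmsRowBound B.Dtmin A (4 + 8 / 3 * R.Gfr 1 * U ^ 2) A₁ L₁ β n (n + 2)
              (|-(2 * π / β)| + (4 + 8 / 3 * R.Gfr 1 * U ^ 2) * klTorusNorm L (Qm - x - y)) L +
            β * (L : ℝ) ^ 2 * klmsRowBound B.Dtmin A (4 + 8 / 3 * R.Gfr 1 * U ^ 2) A₁ L₁ β n (n + 2)
              (|2 * π / β| + (4 + 8 / 3 * R.Gfr 1 * U ^ 2) * klTorusNorm L (Qm - x - y)) L) +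
        ε₁ * (256 / 3 * (β * (L : ℝ) ^ 2) ^ 2 / (klScale klE0 n + t * (klScale klE0 (n + 1) - klScale klE0 n)) ^ 2 *
          ∑ p : FreqMomentum L M, |softSymbolCompl L M β μ K (n + 1) (n + 2) p - softSymbolCompl L M β μ K (n + 1) (n + 1) p| * ‖propCT L M β μ K p‖)) +
      ((β * (L : ℝ) ^ 2) ^ 2 *
          (β * (L : ℝ) ^ 2 * klmsRowBound B.Dtmin A (4 + 8 / 3 * R.Gfr 1 * U ^ 2) A₂ L₂ β n (n + 2)
              (|-(2 * π / β)| + (4 + 8 / 3 * R.Gfr 1 * U ^ 2) * klTorusNorm L (Qm - x - y)) L +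
            β * (L : ℝ) ^ 2 * klmsRowBound B.Dtmin A (4 + 8 / 3 * R.Gfr 1 * U ^ 2) A₂ L₂ β n (n + 2)
              (|2 * π / β| + (4 + 8 / 3 * R.Gfr 1 * U ^ 2) * klTorusNorm L (Qm - x - y)) L) +
        ε₂ * (256 / 3 * (β * (L : ℝ) ^ 2) ^ 2 / (klScale klE0 n + t * (klScale klE0 (n + 1) - klScale klE0 n)) ^ 2 *
          ∑ p : FreqMomentum L M, |softSymbolCompl L M β μ K (n + 1) (n + 2) p - softSymbolCompl L M β μ K (n + 1) (n + 1) p| * ‖propCT L M β μ K p‖)) := by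
  have hβ0 : 0 < β := lt_of_lt_of_le (by norm_num [klBetaMin]) hβ
  have hΛ1 := klth_klScale_pos (n + 1)
  have hq' : (4 + 8 / 3 * R.Gfr 1 * U ^ 2) * klTorusNorm L (Qm - x - y) ≤ (klScale klE0 n + t * (klScale klE0 (n + 1) - klScale klE0 n)) / 13 := by
    have := (scaleAt_mem n ht).1; linarith
  have hq8 : (4 + 8 / 3 * R.Gfr 1 * U ^ 2) * klTorusNorm L (Qm - x - y) ≤ klScale klE0 (n + 1) / 8 := by linarith
  -- (1) reduce the weight to `s_{n+1,n+2} − s_{n+1,n+1}`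
  rw [klms_weighted_crossed_eq_near β μ K hR hK hβ0 n hβn hj ht hq'
    (fun p => softSymbolCompl L M β μ K (n + 1) j p - softSymbolCompl L M β μ K (n + 1) (n + 1) p)
    (fun p => softSymbolCompl L M β μ K (n + 1) (n + 2) p - softSymbolCompl L M β μ K (n + 1) (n + 1) p) (fun k => by ring) Wd hWd]
  -- (2) split the kernel and use additivity
  have e := (pinned_crossed_sum_kernel_congr
      (fun p p' : FreqMomentum L M => matsubaraInt M p'.1 + matsubaraInt M (omega0 M) + matsubaraInt M (omega0 M) + 1 = matsubaraInt M p.1 ∧ p'.2 = p.2 + Qm - x - y)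
      (fun p p' : FreqMomentum L M =>
        (((((softSymbolCompl L M β μ K (n + 1) (n + 2) p - softSymbolCompl L M β μ K (n + 1) (n + 1) p) : ℝ) : ℂ) * (((β * (L : ℝ) ^ 2 : ℝ) : ℂ) * propCT L M β μ K p)) *
            ((((Wd t p') : ℝ) : ℂ) * (((β * (L : ℝ) ^ 2 : ℝ) : ℂ) * propCT L M β μ K p'))) +
          (((((Wd t p) : ℝ) : ℂ) * (((β * (L : ℝ) ^ 2 : ℝ) : ℂ) * propCT L M β μ K p)) *
            ((((softSymbolCompl L M β μ K (n + 1) (n + 2) p' - softSymbolCompl L M β μ K (n + 1) (n + 1) p') : ℝ) : ℂ) * (((β * (L : ℝ) ^ 2 : ℝ) : ℂ) * propCT L M β μ K p'))))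
      hsplit).trans
    (pinned_crossed_sum_kernel_add _ _ F₁ F₂)
  rw [e]
  -- (3) the two generic rows at index `n+2`
  refine (norm_add_le _ _).trans (add_le_add ?_ ?_)
  · exact klms_adjacent_crossed_signed_le_gen β μ K B hR hK hAb hA hA20 hμ n ht hβ hn hβn hM Wd hWd (j := n + 2) (by omega) Qm x y hlo hhi hq8 F₁ F₁₀
      hA1 hL1 hε1 hY0B₁ hY1B₁ hY0A₁ hY1A₁ hflat₁
  · exact klms_adjacent_crossed_signed_le_gen β μ K B hR hK hAb hA hA20 hμ n ht hβ hn hβn hM Wd hWd (j := n + 2) (by omega) Qm x y hlo hhi hq8 F₂ F₂₀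
      hA2 hL2 hε2 hY0B₂ hY1B₂ hY0A₂ hY1A₂ hflat₂

/-! ## §4 The λ/W split of the crossed row -/

/-- **THE PINNED PAIR's CROSSED `D`-ROW, λ/W SPLIT**: `V_j⊗V_j = c + F_W` with `c` CONSTANT (data `(‖c‖, 0, 0)`, proved) and `F_W` with data `(A_W, L_W, ε_W)`. -/
theorem dLine_pinned_crossed_signed_le_split_const (hR : ∀ j, 0 ≤ R.Gfr j) (hK : FrameOK R U N μ K)
    (hAb : ∀ p : Momentum, ∀ j ≤ 2, ‖iteratedFDeriv ℝ j (frameShift K) p‖ ≤ A) (hA : 4 * A < B.Dtmin) (hA20 : 4 * A ≤ 1 / 20) (hμ : μ ≤ -0.15)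
    (n : ℕ) {t : ℝ} (ht : t ∈ Icc (0 : ℝ) 1) (hβ : klBetaMin ≤ β) (hn : n + 1 ≤ nScales β + 1) (hβn : 16 * π / β ≤ klScale klE0 (n + 1))
    (hM : β * (4 * klScale klE0 (n + 1)) / (2 * Real.pi) + 1 ≤ M)
    (Wd : ℝ → FreqMomentum L M → ℝ) (hWd : Wd = fun t k => deriv (fun Λ' : ℝ => hubbardCutoffWeightCT L M β μ K Λ' k) (klScale klE0 n + t * (klScale klE0 (n + 1) - klScale klE0 n)))
    (V : ℕ → ℝ → (Fin 4 → HubbardFieldIdx L M) → ℂ) {j : ℕ} (hj : n + 2 ≤ j) (Qm x y : TorusSite 2 L)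
    (hlo : a' < μ - 4 * klScale klE0 (n + 1) - 4 * A) (hhi : μ + 4 * klScale klE0 (n + 1) + 4 * A < b')
    (hq : (4 + 8 / 3 * R.Gfr 1 * U ^ 2) * klTorusNorm L (Qm - x - y) ≤ klScale klE0 (n + 1) / 16)
    (c : ℂ) (FW : FreqMomentum L M → FreqMomentum L M → ℂ) (FW₀ : TorusSite 2 L → TorusSite 2 L → ℂ)
    (hsplit : ∀ (p p' : FreqMomentum L M),
      V j t ![((p, 0), 1), ((p', 1), 0), (((omega0 M, y), 0), 0), ((((omega0 M).rev, Qm - x), 1), 1)] *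
          V j t ![((p, 0), 0), ((p', 1), 1), ((((omega0 M).rev, Qm - y), 1), 0), (((omega0 M, x), 0), 1)] = c + FW p p')
    {AW LW εW : ℝ} (hAW : 0 ≤ AW) (hLW : 0 ≤ LW) (hεW : 0 ≤ εW)
    (hY0BW : ∀ k : TorusSite 2 L, ‖FW₀ k (k + (Qm - x - y))‖ ≤ AW)
    (hY1BW : ∀ k k' : TorusSite 2 L, ‖FW₀ k (k + (Qm - x - y)) - FW₀ k' (k' + (Qm - x - y))‖ ≤ LW * klTorusNorm L (k - k'))
    (hY0AW : ∀ k : TorusSite 2 L, ‖FW₀ (k + -(Qm - x - y)) k‖ ≤ AW)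
    (hY1AW : ∀ k k' : TorusSite 2 L, ‖FW₀ (k + -(Qm - x - y)) k - FW₀ (k' + -(Qm - x - y)) k'‖ ≤ LW * klTorusNorm L (k - k'))
    (hflatW : ∀ (i i' : MatsubaraIdx M) (k k' : TorusSite 2 L), matsubaraInt M i' + 1 = matsubaraInt M i →
      matsubaraFreq β M i ^ 2 ≤ (5 * klScale klE0 (n + 1)) ^ 2 → ‖FW (i, k) (i', k') - FW₀ k k'‖ ≤ εW) :
    ‖∑ p : FreqMomentum L M, ∑ p' : FreqMomentum L M,
        if matsubaraInt M p'.1 + matsubaraInt M (omega0 M) + matsubaraInt M (omega0 M) + 1 = matsubaraInt M p.1 ∧ p'.2 = p.2 + Qm - x - y then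
          ((((((softSymbolCompl L M β μ K (n + 1) j p - softSymbolCompl L M β μ K (n + 1) (n + 1) p) : ℝ) : ℂ) * (((β * (L : ℝ) ^ 2 : ℝ) : ℂ) * propCT L M β μ K p)) *
                ((((Wd t p') : ℝ) : ℂ) * (((β * (L : ℝ) ^ 2 : ℝ) : ℂ) * propCT L M β μ K p'))) +
              (((((Wd t p) : ℝ) : ℂ) * (((β * (L : ℝ) ^ 2 : ℝ) : ℂ) * propCT L M β μ K p)) *
                ((((softSymbolCompl L M β μ K (n + 1) j p' - softSymbolCompl L M β μ K (n + 1) (n + 1) p') : ℝ) : ℂ) * (((β * (L : ℝ) ^ 2 : ℝ) : ℂ) * propCT L M β μ K p')))) *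
            (V j t ![((p, 0), 1), ((p', 1), 0), (((omega0 M, y), 0), 0), ((((omega0 M).rev, Qm - x), 1), 1)] *
              V j t ![((p, 0), 0), ((p', 1), 1), ((((omega0 M).rev, Qm - y), 1), 0), (((omega0 M, x), 0), 1)])
        else 0‖ ≤
      (β * (L : ℝ) ^ 2) ^ 2 *
          (β * (L : ℝ) ^ 2 * klmsRowBound B.Dtmin A (4 + 8 / 3 * R.Gfr 1 * U ^ 2) ‖c‖ 0 β n (n + 2)
              (|-(2 * π / β)| + (4 + 8 / 3 * R.Gfr 1 * U ^ 2) * klTorusNorm L (Qm - x - y)) L +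
            β * (L : ℝ) ^ 2 * klmsRowBound B.Dtmin A (4 + 8 / 3 * R.Gfr 1 * U ^ 2) ‖c‖ 0 β n (n + 2)
              (|2 * π / β| + (4 + 8 / 3 * R.Gfr 1 * U ^ 2) * klTorusNorm L (Qm - x - y)) L) +
      ((β * (L : ℝ) ^ 2) ^ 2 *
          (β * (L : ℝ) ^ 2 * klmsRowBound B.Dtmin A (4 + 8 / 3 * R.Gfr 1 * U ^ 2) AW LW β n (n + 2)
              (|-(2 * π / β)| + (4 + 8 / 3 * R.Gfr 1 * U ^ 2) * klTorusNorm L (Qm - x - y)) L +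
            β * (L : ℝ) ^ 2 * klmsRowBound B.Dtmin A (4 + 8 / 3 * R.Gfr 1 * U ^ 2) AW LW β n (n + 2)
              (|2 * π / β| + (4 + 8 / 3 * R.Gfr 1 * U ^ 2) * klTorusNorm L (Qm - x - y)) L) +
        εW * (256 / 3 * (β * (L : ℝ) ^ 2) ^ 2 / (klScale klE0 n + t * (klScale klE0 (n + 1) - klScale klE0 n)) ^ 2 *
          ∑ p : FreqMomentum L M, |softSymbolCompl L M β μ K (n + 1) (n + 2) p - softSymbolCompl L M β μ K (n + 1) (n + 1) p| * ‖propCT L M β μ K p‖)) := by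
  have h := dLine_pinned_crossed_signed_le_split β μ K B hR hK hAb hA hA20 hμ n ht hβ hn hβn hM Wd hWd V hj Qm x y hlo hhi hq
    (fun _ _ => c) FW (fun _ _ => c) FW₀ hsplit (A₁ := ‖c‖) (L₁ := 0) (ε₁ := 0) (norm_nonneg c) le_rfl le_rfl hAW hLW hεW
    (fun k => le_rfl) (fun k k' => by simp) (fun k => le_rfl) (fun k k' => by simp) (fun i i' k k' _ _ => by simp)
    hY0BW hY1BW hY0AW hY1AW hflatW
  simpa only [zero_mul, add_zero] using h

end Split

end Summit.HubbardSuperconductivity.HubbardSuperconductivity.Theorems.KLRegimeSplit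

end
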